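import Summits.CriticalPhenomena.PercolationContinuityZ3.Theorems.SahiMasterFamilyCoordPoly
import Literature.Combinatorics.Sahi2008.UniformSquareAllOrders
import Mathlib.Analysis.Calculus.MeanValue
import Mathlib.Analysis.Calculus.Deriv.Polynomial
import HarnessLib

/-!
# THEOREM R: Sahi positivity under a product measure follows from the FIRST BERNSTEIN COEFFICIENT of each coordinate step
# (one-sided log-derivative schema along one coin, every order, every family vanishing at `∅`)

Support file of the Sahi / hitting-event programme (seat `prim-l12-p5`, gen 16; `--supports stmt-CriticalPhenomena-4575`).
No definitions, no named facts, no sorries; standard axioms.  Memo `run/shared/lean/prim/prim-l12/FROM-prim-l12-p5-g15-FCL-ORDER3-AND-FLOW-REDUCTION.md`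
§3 ("Theorem R", paper) and `…/FROM-prim-l12-p5-g16-FCL-REFUTED-ON-CUBES.md` (this gen).

SETTING.  `bernoulliWeight p` on the cube `Set ι` (`ι` finite), a family `F : Fin k → Set ι → ℝ` with `F_j(∅) = 0` (e.g. indicators of
hitting events `H_A = {ω | ∃ a ∈ A, a ∈ ω}`, or of any increasing events other than `Ω`), and a coin `x`.  Along the bias `s = p_x` the functional
`s ↦ E_k(μ_{p[x↦s]}; F)` is the polynomial `Q_{p,x} = sahiEP (secPoly p x) k F` of prim-master-conj's `SahiMasterFamilyCoordPoly` (degree `≤ k`;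
`sahiE_update_eq_eval`), and it does not depend on `p_x` (`secPoly_update_same`).

**THEOREM R (`sahiE_bernoulliWeight_nonneg_of_logDeriv`).**  Fix exponents `t : ι → ℕ`.  If for every bias vector `p` and every coin `x`
  `t_x · Q_{p,x}(p_x) + (1 − p_x) · Q'_{p,x}(p_x) ≥ 0`                                                        (R_x)
then `E_k(μ_p; F) ≥ 0` for every `p`.  Quantitatively (`sahiE_bernoulliWeight_ge_pow_mul`): (R_x) along the fibre of `x` alone gives
`E_k(μ_p; F) ≥ (1 − p_x)^{t_x} · E_k(μ_{p[x↦0]}; F)`.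
For HITTING families (`sahiE_hit_nonneg_of_logDeriv`) with `t_x = #{j : x ∈ A_j}`, (R_x) is EXACTLY "the first Bernstein coefficient `b₁` of the
fresh-coin push-up is `≥ 0`": OR-ing a fresh coin of type `T_x = {j : x ∈ A_j}` and bias `u` onto the current law is the re-parametrisation
`s = p_x + (1 − p_x)u` (two coins of one type merge), the push-up polynomial `P(u) = Q(p_x + (1−p_x)u)` has degree `≤ t_x`, `P(0) = Q(p_x)`,
`P'(0) = (1−p_x)Q'(p_x)` (`eval_pushup_zero`, `derivative_pushup_eval_zero`), and `b₁(P) = P(0) + P'(0)/t_x`.  So Q-OR at order `k`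
(Sahi positivity of every hitting family of `k` events under every product measure) follows from the nonnegativity of the `a = 1` COIN-STEP CELLS
`(k, T, a=1)` of the census lane (ttrl COIN.md §3) alone — the memo's Theorem R, here for every order in the kernel.  The cells `b₂, b₃, …`
(e.g. the FF-needing cell `(5,11100)`, `a = 2`) are never needed.

PROOF.  One-variable comparison (`ge_pow_mul_of_logDeriv_nonneg`, the exponent-`t` version of prim-ineq-gen-4's `…LogDerivSchema.ge_sq_mul_of_logDeriv_nonneg`):
if `f` is differentiable and `t f + (1−s) f' ≥ 0` on `[0,1)` then `f/(1−s)^t` is non-decreasing there, so `f(s) ≥ (1−s)^t f(0)`; at `s = 1` by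
continuity.  Induction on the set of coins with non-zero bias: kill the bias of one coin `x` (`p[x↦0]`, fewer live coins, `E ≥ 0` by induction),
and climb back along the fibre with the comparison lemma, (R_x) being available at every point of the fibre because `p[x↦s]` is again a bias
vector; the base (all biases `0`, the measure is `δ_∅`) has all joint moments `0` by `F_j(∅) = 0`, hence `E_k = E_k(0,…,0) = 0`.
HONEST FRAMING: a reduction; the hypothesis (R_x) for hitting families (census: 0 failures for `k ≤ 7`, exact certificates for all `a = 1` cells
at `k ≤ 5`) is OPEN for `k ≥ 6` and is NOT asserted here. [this work]
-/

noncomputable section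

open scoped Classical

namespace Summit.CriticalPhenomena.PercolationContinuityZ3.Theorems

namespace SahiHittingFirstBernstein

open Finset Function Polynomial Set
open Literature.Combinatorics.Sahi2008
open Literature.Probability.Percolation.DecisionTree (ind ind_of_mem ind_of_not_mem ind_nonneg)

/-! ### 1. The one-variable comparison lemma (exponent `t`) -/

/-- **ODE comparison, exponent `t`.**  If `f` is differentiable and `t·f(s) + (1−s)·f'(s) ≥ 0` for all `s ∈ [0,1)`, then
`(1−s)^t · f(0) ≤ f(s)` on `[0,1)` (the quotient `f/(1−s)^t` is non-decreasing). [folklore] -/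
theorem ge_pow_mul_of_logDeriv_nonneg {f : ℝ → ℝ} (hf : Differentiable ℝ f) (t : ℕ)
    (hM : ∀ s ∈ Ico (0 : ℝ) 1, 0 ≤ (t : ℝ) * f s + (1 - s) * deriv f s) :
    ∀ s ∈ Ico (0 : ℝ) 1, (1 - s) ^ t * f 0 ≤ f s := by
  set g : ℝ → ℝ := fun s => f s / (1 - s) ^ t with hg
  have hpos : ∀ s ∈ Ico (0 : ℝ) 1, 0 < (1 - s) ^ t := fun s hs => by
    have : 0 < 1 - s := by linarith [hs.2]
    positivity
  have hden : ∀ s ∈ Ico (0 : ℝ) 1, (1 - s) ^ t ≠ 0 := fun s hs => (hpos s hs).ne'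
  have hderiv : ∀ s ∈ Ico (0 : ℝ) 1,
      HasDerivAt g ((deriv f s * (1 - s) ^ t - f s * ((t : ℝ) * (1 - s) ^ (t - 1) * (-1))) / ((1 - s) ^ t) ^ 2) s := by
    intro s hs
    have h1 : HasDerivAt (fun x : ℝ => (1 - x) ^ t) ((t : ℝ) * (1 - s) ^ (t - 1) * (-1)) s :=
      ((hasDerivAt_id s).const_sub 1).pow t
    exact (hf s).hasDerivAt.div h1 (hden s hs)
  -- the numerator of `g'` is `(1−s)^{t−1}·[t f + (1−s) f']` for `t ≥ 1`, and `f'·1 = (1−s)f'/(1−s)` for `t = 0`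
  have hnum : ∀ s ∈ Ico (0 : ℝ) 1,
      0 ≤ deriv f s * (1 - s) ^ t - f s * ((t : ℝ) * (1 - s) ^ (t - 1) * (-1)) := by
    intro s hs
    have h1s : 0 < 1 - s := by linarith [hs.2]
    have hMs := hM s hs
    rcases Nat.eq_zero_or_pos t with ht | ht
    · subst ht
      simp only [pow_zero, mul_one, CharP.cast_eq_zero, zero_mul, mul_zero, sub_zero, zero_add] at hMs ⊢
      nlinarith [hMs, h1s]
    · obtain ⟨u, rfl⟩ : ∃ u, t = u + 1 := ⟨t - 1, by omega⟩
      have e : deriv f s * (1 - s) ^ (u + 1) - f s * (((u + 1 : ℕ) : ℝ) * (1 - s) ^ (u + 1 - 1) * (-1)) =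
          (1 - s) ^ u * (((u + 1 : ℕ) : ℝ) * f s + (1 - s) * deriv f s) := by
        rw [Nat.add_sub_cancel, pow_succ]
        ring
      rw [e]
      exact mul_nonneg (pow_nonneg h1s.le u) hMs
  have hmono : MonotoneOn g (Ico (0 : ℝ) 1) := by
    refine monotoneOn_of_deriv_nonneg (convex_Ico 0 1) ?_ ?_ ?_
    · exact fun s hs => (hderiv s hs).continuousAt.continuousWithinAt
    · rw [interior_Ico]
      exact fun s hs => (hderiv s (Ioo_subset_Ico_self hs)).differentiableAt.differentiableWithinAt
    · rw [interior_Ico]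
      intro s hs
      have hs' : s ∈ Ico (0 : ℝ) 1 := Ioo_subset_Ico_self hs
      rw [(hderiv s hs').deriv]
      exact div_nonneg (hnum s hs') (sq_nonneg _)
  intro s hs
  have h0 : (0 : ℝ) ∈ Ico (0 : ℝ) 1 := ⟨le_rfl, zero_lt_one⟩
  have hle : g 0 ≤ g s := hmono h0 hs hs.1
  have hg0 : g 0 = f 0 := by simp [hg]
  rw [hg0] at hle
  have hle' : f 0 ≤ f s / (1 - s) ^ t := hle
  have := (le_div_iff₀ (hpos s hs)).1 hle'
  linarith

/-- **Positivity from the one-sided schema, exponent `t`.**  If `f` is differentiable, `f(0) ≥ 0` and `t f + (1−s) f' ≥ 0` on `[0,1)`, then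
`f ≥ 0` on `[0,1]` (on `[0,1)` by `ge_pow_mul_of_logDeriv_nonneg`, at `s = 1` by continuity). [folklore] -/
theorem nonneg_of_logDeriv_nonneg_pow {f : ℝ → ℝ} (hf : Differentiable ℝ f) (t : ℕ) (h0 : 0 ≤ f 0)
    (hM : ∀ s ∈ Ico (0 : ℝ) 1, 0 ≤ (t : ℝ) * f s + (1 - s) * deriv f s) :
    ∀ s ∈ Icc (0 : ℝ) 1, 0 ≤ f s := by
  have hIco : ∀ s ∈ Ico (0 : ℝ) 1, 0 ≤ f s := fun s hs =>
    le_trans (mul_nonneg (pow_nonneg (by linarith [hs.2]) t) h0) (ge_pow_mul_of_logDeriv_nonneg hf t hM s hs)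
  have hclosed : IsClosed {s : ℝ | 0 ≤ f s} := isClosed_le continuous_const hf.continuous
  have hsub : Icc (0 : ℝ) 1 ⊆ {s : ℝ | 0 ≤ f s} := by
    have : closure (Ico (0 : ℝ) 1) ⊆ {s : ℝ | 0 ≤ f s} := hclosed.closure_subset_iff.2 hIco
    rwa [closure_Ico zero_ne_one] at this
  exact fun s hs => hsub hs

/-- Polynomial form of the comparison: for `Q ∈ ℝ[X]` with `Q(0) ≥ 0` and `t·Q(s) + (1−s)·Q'(s) ≥ 0` on `[0,1)`, `Q ≥ 0` on `[0,1]`. [folklore] -/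
theorem eval_nonneg_of_logDeriv_nonneg (Q : ℝ[X]) (t : ℕ) (h0 : 0 ≤ Q.eval 0)
    (hM : ∀ s ∈ Ico (0 : ℝ) 1, 0 ≤ (t : ℝ) * Q.eval s + (1 - s) * Q.derivative.eval s) :
    ∀ s ∈ Icc (0 : ℝ) 1, 0 ≤ Q.eval s := by
  refine nonneg_of_logDeriv_nonneg_pow (f := fun s => Q.eval s) Q.differentiable t h0 fun s hs => ?_
  rw [Polynomial.deriv]
  exact hM s hs

/-- Polynomial form of the quantitative comparison: `Q(s) ≥ (1−s)^t Q(0)` on `[0,1]`. [folklore] -/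
theorem eval_ge_pow_mul_of_logDeriv_nonneg (Q : ℝ[X]) (t : ℕ)
    (hM : ∀ s ∈ Ico (0 : ℝ) 1, 0 ≤ (t : ℝ) * Q.eval s + (1 - s) * Q.derivative.eval s) :
    ∀ s ∈ Icc (0 : ℝ) 1, (1 - s) ^ t * Q.eval 0 ≤ Q.eval s := by
  have hIco : ∀ s ∈ Ico (0 : ℝ) 1, (1 - s) ^ t * Q.eval 0 ≤ Q.eval s := by
    refine ge_pow_mul_of_logDeriv_nonneg (f := fun s => Q.eval s) Q.differentiable t fun s hs => ?_
    rw [Polynomial.deriv]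
    exact hM s hs
  have hcont : Continuous fun s : ℝ => Q.eval s - (1 - s) ^ t * Q.eval 0 := by fun_prop
  have hclosed : IsClosed {s : ℝ | 0 ≤ Q.eval s - (1 - s) ^ t * Q.eval 0} := isClosed_le continuous_const hcont
  have hsub : Icc (0 : ℝ) 1 ⊆ {s : ℝ | 0 ≤ Q.eval s - (1 - s) ^ t * Q.eval 0} := by
    have : closure (Ico (0 : ℝ) 1) ⊆ {s : ℝ | 0 ≤ Q.eval s - (1 - s) ^ t * Q.eval 0} :=
      hclosed.closure_subset_iff.2 fun s hs => sub_nonneg.2 (hIco s hs)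
    rwa [closure_Ico zero_ne_one] at this
  exact fun s hs => sub_nonneg.1 (hsub hs)

/-! ### 2. The push-up re-parametrisation (why (R_x) is "first Bernstein coefficient ≥ 0") -/

/-- The push-up polynomial `P(u) = Q(a + (1−a)u)` has `P(0) = Q(a)`. [folklore] -/
theorem eval_pushup_zero (Q : ℝ[X]) (a : ℝ) : (Q.comp (C a + C (1 - a) * X)).eval 0 = Q.eval a := by
  simp [eval_comp]

/-- … and `P'(0) = (1−a)·Q'(a)` (chain rule): so `t·P(0) + P'(0) = t·Q(a) + (1−a)·Q'(a)`, i.e. (R_x) at bias `a` says that `P(0) + P'(0)/t`, the first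
Bernstein coefficient of the degree-`t` push-up polynomial, is nonnegative. [folklore] -/
theorem derivative_pushup_eval_zero (Q : ℝ[X]) (a : ℝ) :
    (derivative (Q.comp (C a + C (1 - a) * X))).eval 0 = (1 - a) * Q.derivative.eval a := by
  rw [derivative_comp]
  simp [eval_comp]

/-! ### 3. One coordinate of a product measure -/

section Coordinate

variable {ι : Type*} [Fintype ι]

/-- The off-`x` weight does not depend on `p_x`. [folklore] -/
theorem offWeight_update_same (p : ι → unitInterval) (x : ι) (s : unitInterval) (ω : Set ι) :
    offWeight (update p x s) x ω = offWeight p x ω := by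
  unfold offWeight
  refine prod_congr rfl fun i hi => ?_
  rw [update_of_ne (ne_of_mem_erase hi)]

/-- The section moments off `x` do not depend on `p_x`. [folklore] -/
theorem secEx_update_same (p : ι → unitInterval) (x : ι) (s : unitInterval) (h : Set ι → ℝ) (b : Bool) :
    secEx (update p x s) x h b = secEx p x h b := by
  unfold secEx
  exact sum_congr rfl fun ω _ => by rw [offWeight_update_same]

/-- The affine moment map of `x` does not depend on `p_x`. [this work] -/
theorem secPoly_update_same (p : ι → unitInterval) (x : ι) (s : unitInterval) :
    secPoly (update p x s) x = secPoly p x := by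
  funext h
  rw [secPoly, secPoly, secEx_update_same, secEx_update_same]

/-- With all biases `0` the product weight is `δ_∅`: it vanishes off the empty configuration. [folklore] -/
theorem bernoulliWeight_eq_zero_of_forall {p : ι → unitInterval} (hp : ∀ y, p y = 0) {ω : Set ι} (hω : ω ≠ ∅) :
    bernoulliWeight p ω = 0 := by
  obtain ⟨i, hi⟩ := Set.nonempty_iff_ne_empty.2 hω
  show (∏ e, if e ∈ ω then ((p e : unitInterval) : ℝ) else 1 - (p e : ℝ)) = 0
  exact prod_eq_zero (mem_univ i) (by rw [if_pos hi, hp i]; rfl)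

/-- With all biases `0`, a product of members of a family vanishing at `∅` has expectation `0` (nonempty product). [folklore] -/
theorem ex_prod_eq_zero_of_forall {p : ι → unitInterval} (hp : ∀ y, p y = 0) {k : ℕ} {F : Fin k → Set ι → ℝ}
    (hF : ∀ j, F j ∅ = 0) {S : Finset (Fin k)} (hS : S.Nonempty) :
    ex (bernoulliWeight p) (∏ j ∈ S, F j) = 0 := by
  rw [ex_def]
  refine sum_eq_zero fun ω _ => ?_
  by_cases hω : ω = ∅
  · subst hω
    obtain ⟨j, hj⟩ := hS
    rw [Finset.prod_apply, prod_eq_zero hj (hF j), mul_zero]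
  · rw [bernoulliWeight_eq_zero_of_forall hp hω, zero_mul]

/-- **Base case**: with all biases `0`, `E_k(μ_p; F) = 0` for a family vanishing at `∅` (all joint moments vanish). [this work] -/
theorem sahiE_eq_zero_of_forall {p : ι → unitInterval} (hp : ∀ y, p y = 0) {k : ℕ} (F : Fin k → Set ι → ℝ)
    (hF : ∀ j, F j ∅ = 0) : sahiE (bernoulliWeight p) k F = 0 := by
  have h := sahiE_congr_of_moments (bernoulliWeight p) (bernoulliWeight p) k F (fun _ => (0 : Set ι → ℝ)) fun S hS => by
    rw [ex_prod_eq_zero_of_forall hp hF hS]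
    obtain ⟨j, hj⟩ := hS
    rw [prod_eq_zero hj rfl, ex_def]
    simp
  rw [h]
  cases k with
  | zero => rw [sahiE_zero]
  | succ m =>
    have h0 := sahiE_update_zero (bernoulliWeight p) (fun _ : Fin (m + 1) => (0 : Set ι → ℝ)) 0
    rwa [update_eq_self_iff.2 rfl] at h0

/-! ### 4. THEOREM R -/

/-- **One coordinate climbed** (the quantitative step).  If (R_x) holds along the whole fibre of `x` through `p` — `t·Q(s) + (1−s)Q'(s) ≥ 0` for
`s ∈ [0,1)`, `Q = sahiEP (secPoly p x) k F` — then `E_k(μ_p; F) ≥ (1 − p_x)^t · E_k(μ_{p[x↦0]}; F)`. [this work] -/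
theorem sahiE_bernoulliWeight_ge_pow_mul (p : ι → unitInterval) (x : ι) {k : ℕ} (F : Fin k → Set ι → ℝ) (t : ℕ)
    (hR : ∀ s ∈ Ico (0 : ℝ) 1, 0 ≤ (t : ℝ) * (sahiEP (secPoly p x) k F).eval s
      + (1 - s) * (derivative (sahiEP (secPoly p x) k F)).eval s) :
    (1 - (p x : ℝ)) ^ t * sahiE (bernoulliWeight (update p x 0)) k F ≤ sahiE (bernoulliWeight p) k F := by
  have h := eval_ge_pow_mul_of_logDeriv_nonneg (sahiEP (secPoly p x) k F) t hR (p x) ⟨(p x).2.1, (p x).2.2⟩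
  rw [sahiE_update_eq_eval p x 0 k F]
  conv_rhs => rw [← update_eq_self x p, sahiE_update_eq_eval p x (p x) k F]
  simpa using h

/-- **THEOREM R.**  Let `F : Fin k → Set ι → ℝ` vanish at the empty configuration (`F_j(∅) = 0`) and `t : ι → ℕ`.  If for every bias vector `p`
and every coin `x`, `t_x · Q_{p,x}(p_x) + (1 − p_x) · Q'_{p,x}(p_x) ≥ 0` with `Q_{p,x} = sahiEP (secPoly p x) k F` (the polynomial
`s ↦ E_k(μ_{p[x↦s]}; F)`), then `E_k(μ_p; F) ≥ 0` for EVERY `p`. [this work] -/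
theorem sahiE_bernoulliWeight_nonneg_of_logDeriv {k : ℕ} (F : Fin k → Set ι → ℝ) (hF : ∀ j, F j ∅ = 0) (t : ι → ℕ)
    (hR : ∀ (p : ι → unitInterval) (x : ι),
      0 ≤ (t x : ℝ) * (sahiEP (secPoly p x) k F).eval (p x : ℝ)
        + (1 - (p x : ℝ)) * (derivative (sahiEP (secPoly p x) k F)).eval (p x : ℝ))
    (p : ι → unitInterval) : 0 ≤ sahiE (bernoulliWeight p) k F := by
  -- induction on a finite set of coins outside which all biases vanish
  suffices key : ∀ (K : Finset ι) (p : ι → unitInterval), (∀ y, y ∉ K → p y = 0) → 0 ≤ sahiE (bernoulliWeight p) k F from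
    key Finset.univ p fun y hy => absurd (Finset.mem_univ y) hy
  intro K
  induction K using Finset.induction_on with
  | empty =>
    intro p hp
    rw [sahiE_eq_zero_of_forall (fun y => hp y (Finset.notMem_empty y)) F hF]
  | insert x K' hx ih =>
    intro p hp
    -- kill the bias of `x`
    have h0 : 0 ≤ sahiE (bernoulliWeight (update p x 0)) k F := by
      refine ih (update p x 0) fun y hy => ?_
      by_cases hyx : y = x
      · subst hyx; exact update_self _ _ _
      · rw [update_of_ne hyx]
        exact hp y (by rw [Finset.mem_insert, not_or]; exact ⟨hyx, hy⟩)
    -- (R_x) along the fibre of `x` through `p`: `p[x↦s]` is again a bias vector, with the same polynomial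
    have hfib : ∀ s ∈ Ico (0 : ℝ) 1, 0 ≤ (t x : ℝ) * (sahiEP (secPoly p x) k F).eval s
        + (1 - s) * (derivative (sahiEP (secPoly p x) k F)).eval s := by
      intro s hs
      have h := hR (update p x ⟨s, hs.1, hs.2.le⟩) x
      rwa [secPoly_update_same, update_self] at h
    exact le_trans (mul_nonneg (pow_nonneg (sub_nonneg.2 (p x).2.2) _) h0) (sahiE_bernoulliWeight_ge_pow_mul p x F (t x) hfib)

/-- **THEOREM R for hitting families (Q-OR from the `a = 1` cells).**  For finite sets `A_0,…,A_{k−1} ⊆ ι` and ANY exponents `t : ι → ℕ`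
(the meaningful choice being `t_x = #{j : x ∈ A_j}`, for which the hypothesis is "first Bernstein coefficient of the fresh-coin push-up `≥ 0`"):
if `t_x·Q(p_x) + (1−p_x)Q'(p_x) ≥ 0` for every `p` and `x`, `Q = sahiEP (secPoly p x) k (1_{H_{A_j}})_j`, then
`0 ≤ E_k(1_{H_{A_0}},…,1_{H_{A_{k−1}}})` under every product weight. [this work] -/
theorem sahiE_hit_nonneg_of_logDeriv {k : ℕ} (A : Fin k → Finset ι) (t : ι → ℕ)
    (hR : ∀ (p : ι → unitInterval) (x : ι),
      0 ≤ (t x : ℝ) * (sahiEP (secPoly p x) k (fun j => ind {ω : Set ι | ∃ a ∈ A j, a ∈ ω})).eval (p x : ℝ)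
        + (1 - (p x : ℝ)) * (derivative (sahiEP (secPoly p x) k (fun j => ind {ω : Set ι | ∃ a ∈ A j, a ∈ ω}))).eval (p x : ℝ))
    (p : ι → unitInterval) :
    0 ≤ sahiE (bernoulliWeight p) k (fun j => ind {ω : Set ι | ∃ a ∈ A j, a ∈ ω}) :=
  sahiE_bernoulliWeight_nonneg_of_logDeriv _ (fun j => ind_of_not_mem (by simp)) t hR p

end Coordinate

end SahiHittingFirstBernstein

end Summit.CriticalPhenomena.PercolationContinuityZ3.Theorems

end
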